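import Summits.BirchSwinnertonDyer.BirchSwinnertonDyer.Theses.TeichmullerTwistDescent
import Summits.BirchSwinnertonDyer.BirchSwinnertonDyer.Theorems.TeichmullerTwistDescentCarrierMultOne
import Literature.NumberTheory.DiophantineGeometry.ConductorFactorizationProofs
import Literature.NumberTheory.DiophantineGeometry.ConductorExponentLeTwoProofs
import Literature.NumberTheory.ModularSymbols.FullLevelHomologyComplexConj
import HarnessLib

/-!
# Route `TeichmullerTwistDescent`, crux K `TwistedPeriodLatticeSaturation` (stmt-BirchSwinnertonDyer-25368):
# K, LITERALLY, from modularity + multiplicity one + the integral tame-type carrier functional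

Cell `pub/bsd-wall` (D-0145 line route-BirchSwinnertonDyer-TeichmullerTwistDescent, OPEN rev 7), seat `bsd-line-ttd-p1`
(prover 1/2, g24).  THEOREMS ONLY (no definition, no named fact, no `sorry`).  BSD is not proved by this file; K is NOT
proved by this file: the main theorem is CONDITIONAL — its conclusion is the route decl
`Summit.…Theses.TeichmullerTwistDescent.TwistedPeriodLatticeSaturation` verbatim, its hypotheses are the three remaining
inputs of the K-line, each a closed `∀`-statement spelled out in the binder (no new definition):

* `hnf : exists_isNewformOf` (modularity, the tree's named fact);
* `hM1` — MULTIPLICITY ONE in the operator-free form `MultOneHyp ℤ_p p M hpM D.f` of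
  `Literature.…FullLevelHomologySpreadKernel`, for the newform `D.f` of every modular parametrization datum of a curve of
  conductor `p²M`, `p ∤ M`;
* `hcar` — the INTEGRAL TAME-TYPE CARRIER FUNCTIONAL: for such `(W, p, M, D)` in the situation of K (`p ≥ 11`, additive,
  `E[p]` irreducible, (G)-ordinary, `v_p(Δ_min) ≤ 4`) there are `0 < b`, `2b < p − 1`, a `ℤ_p`-linear functional `Ψ` on the
  spread lattice `Λ_Q(f_D) ⊂ Fun(GL₂(ℤ/p), ℤ_p ⊗ Λ(f_D))`, equivariant for the principal series `coordRep(ω̃^{p−1−b}, ω̃^b)`,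
  with image of finite index (`p^m`) whose reduction has socle `⊆ Sym^{2b} ⊗ det^{−b}` (`ReductionSocleLe`, read over the
  residue field `ℤ/p` with its `ℤ_p`-algebra structure `PadicInt.toZMod`).

Plumbing proved here: `conductorNorm_eq_sq_mul_coprime` (`p² ∣ N(W)`, `p ≥ 5` ⇒ `N(W) = p²M`, `p ∤ M`, from the tree's
`f_p ≤ 2` and `N = ∏ p^{f_p}`), `isUnit_natCast_padicInt_of_not_dvd`, `isUnit_card_diagTorus` (`|T̃| = (p−1)² ∈ ℤ_pˣ`),
and the main theorem **`twistedPeriodLatticeSaturation_of_carrier`**.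
-/

set_option linter.dupNamespace false

noncomputable section

open scoped Pointwise MatrixGroups TensorProduct

open Function CongruenceSubgroup
open Literature.RepresentationTheory.FiniteGroups Literature.RepresentationTheory.FiniteGroups.GL2
  Literature.NumberTheory.EllipticCurves.ModularForms
open Literature.NumberTheory.EllipticCurves (Kato2004.teichmullerChar)
open Literature.NumberTheory.ModularSymbols Literature.NumberTheory.ModularSymbols.FullLevel
open Literature.Algebra.Homology

namespace Summit.BirchSwinnertonDyer.BirchSwinnertonDyer.Theorems.TeichmullerTwistDescent.KOfCarrier

open WeierstrassCurve Literature.NumberTheory.EllipticCurves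
  Summit.BirchSwinnertonDyer.BirchSwinnertonDyer.Theorems.TeichmullerTwistDescent.CarrierMultOne

/-- **`p² ∣ N(W)` and `p ≥ 5` ⇒ `N(W) = p²M` with `p ∤ M`** (the conductor exponent at `p ≥ 5` is `≤ 2`:
`conductorExponent_le_two_of_five_le_natGenerator_holds`, and `N = ∏ p^{f_p}`: `factorization_conductorNorm_holds`).
[cite: SilvermanATAEC1994, Thm. IV.10.2] -/
theorem conductorNorm_eq_sq_mul_coprime (W : WeierstrassCurve ℚ) [W.IsElliptic] (p : ℕ) [hp : Fact p.Prime] (hp5 : 5 ≤ p)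
    (hsq : p ^ 2 ∣ W.conductorNorm ℤ) : ∃ M : ℕ, W.conductorNorm ℤ = p ^ 2 * M ∧ Nat.Coprime p M := by
  set v₀ : IsDedekindDomain.HeightOneSpectrum ℤ := (Rat.HeightOneSpectrum.primesEquiv (R := ℤ)).symm ⟨p, hp.out⟩ with hv₀
  have hgen : Rat.HeightOneSpectrum.natGenerator v₀ = p :=
    congrArg (fun q : Nat.Primes => (q : ℕ)) ((Rat.HeightOneSpectrum.primesEquiv (R := ℤ)).apply_symm_apply ⟨p, hp.out⟩)
  have hN0 : W.conductorNorm ℤ ≠ 0 := (W.conductorNorm_pos_holds).ne'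
  have hf : (W.conductorNorm ℤ).factorization p ≤ 2 := by
    have h := W.factorization_conductorNorm_holds v₀
    rw [hgen] at h
    rw [h]
    exact W.conductorExponent_le_two_of_five_le_natGenerator_holds v₀ (by rw [hgen]; exact hp5)
  have h2 : 2 ≤ (W.conductorNorm ℤ).factorization p := (hp.out.pow_dvd_iff_le_factorization hN0).mp hsq
  have hfac : (W.conductorNorm ℤ).factorization p = 2 := le_antisymm hf h2
  obtain ⟨M, hM⟩ := hsq
  refine ⟨M, hM, (Nat.Prime.coprime_iff_not_dvd hp.out).mpr ?_⟩
  have h := Nat.not_dvd_ordCompl hp.out hN0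
  rwa [hfac, hM, Nat.mul_div_cancel_left _ (pow_pos hp.out.pos 2)] at h

/-- A natural number prime to `p` is a unit of `ℤ_p`. [cite: SilvermanATAEC1994, §IV.10] -/
theorem isUnit_natCast_padicInt_of_not_dvd (p : ℕ) [hp : Fact p.Prime] {n : ℕ} (hn : ¬ p ∣ n) : IsUnit (n : ℤ_[p]) := by
  rw [PadicInt.isUnit_iff]
  have hlt := PadicInt.norm_int_lt_one_iff_dvd (p := p) n
  rw [Int.cast_natCast, Int.natCast_dvd_natCast] at hlt
  exact le_antisymm (PadicInt.norm_le_one _) (not_lt.1 (mt hlt.1 hn))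

/-- **`|T̃(ℤ/p)| = (p − 1)²` is a unit of `ℤ_p`**: the hypothesis `[Invertible (|T̃| : ℤ_p)]` of the up/down dictionary is
dischargeable (`natCard_diagTorus_zmod`). [cite: Shimura1971, §3.3] -/
theorem isUnit_card_diagTorus (p : ℕ) [hp : Fact p.Prime] [Fintype (diagTorus (ZMod p))] :
    IsUnit (Fintype.card (diagTorus (ZMod p)) : ℤ_[p]) := by
  apply isUnit_natCast_padicInt_of_not_dvd
  rw [Fintype.card_eq_nat_card, natCard_diagTorus_zmod]
  intro h
  have hp2 := hp.out.two_le
  have h1 : p ∣ p - 1 := ((Nat.Prime.dvd_mul hp.out).mp (by simpa [pow_two] using h)).elim id id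
  have := Nat.le_of_dvd (by omega) h1
  omega

/-- **K from modularity, multiplicity one and the integral tame-type carrier functional.**  The conclusion is the route
decl `TwistedPeriodLatticeSaturation` VERBATIM; the three hypotheses are the remaining inputs of the K-line (see the module
docstring) — BSD is not proved by this, K is proved only CONDITIONALLY on them.  Proof: split `N(W) = p²M` (`p ∤ M`,
`conductorNorm_eq_sq_mul_coprime`), equip `T̃(ℤ/p)` with its `Fintype` structure and `(p−1)² ∈ ℤ_pˣ`, read the residue field
as `ℤ/p` (`PadicInt.toZMod`), and apply `CarrierMultOne.saturation_at_of_carrier_of_multOne`.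
[cite: EdixhovenManin1991, §4] [cite: EmertonGeeSavitt2015, Lemma 4.1.1] [cite: AshStevens1986, §1 (1.2)–(1.4)] -/
theorem twistedPeriodLatticeSaturation_of_carrier (hnf : exists_isNewformOf)
    (hM1 : ∀ (p M : ℕ) [Fact p.Prime] [NeZero M] [NeZero (p ^ 2 * M)] (hpM : Nat.Coprime p M)
      [Fintype (diagTorus (ZMod p))] [Invertible (Fintype.card (diagTorus (ZMod p)) : ℤ_[p])]
      (W : WeierstrassCurve ℚ) [W.IsElliptic] [W.IsGloballyMinimal], W.conductorNorm ℤ = p ^ 2 * M →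
      ∀ D : ModularParametrizationData W (p ^ 2 * M), MultOneHyp ℤ_[p] p M hpM D.f)
    (hcar : ∀ (p M : ℕ) [Fact p.Prime] [NeZero M] [NeZero (p ^ 2 * M)] (hpM : Nat.Coprime p M)
      [Fintype (diagTorus (ZMod p))] [Invertible (Fintype.card (diagTorus (ZMod p)) : ℤ_[p])]
      (W : WeierstrassCurve ℚ) [W.IsElliptic] [W.IsGloballyMinimal], W.conductorNorm ℤ = p ^ 2 * M →
      ∀ D : ModularParametrizationData W (p ^ 2 * M), 11 ≤ p → Rank1Residual.Addv W p → Rank1Residual.Irr W p →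
      Summit.BirchSwinnertonDyer.Rank1Residual.Additive.TypeGOrd W p → padicValInt p W.minimalDiscriminantInt ≤ 4 →
      ∃ (b m : ℕ) (Ψ : spreadLattice ℤ_[p] p M hpM D.f →ₗ[ℤ_[p]] (Option (ZMod p) → ℤ_[p])),
        0 < b ∧ 2 * b < p - 1 ∧
        IsEquivariantOnSpread ℤ_[p] p M hpM D.f
          (coordRep (Kato2004.teichmullerChar p ^ (p - 1 - b)) (Kato2004.teichmullerChar p ^ b)) Ψ ∧
        (∀ v : Option (ZMod p) → ℤ_[p], (p : ℤ_[p]) ^ m • v ∈ LinearMap.range Ψ) ∧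
        ∀ Λ' : Subrepresentation (coordRep (Kato2004.teichmullerChar p ^ (p - 1 - b)) (Kato2004.teichmullerChar p ^ b)),
          Λ'.toSubmodule = LinearMap.range Ψ →
            @ReductionSocleLe p _ (ZMod p) _ _ (PadicInt.toZMod (p := p)).toAlgebra
              (Kato2004.teichmullerChar p ^ (p - 1 - b)) (Kato2004.teichmullerChar p ^ b) (2 * b) Λ') :
    Summit.BirchSwinnertonDyer.BirchSwinnertonDyer.Theses.TeichmullerTwistDescent.TwistedPeriodLatticeSaturation := by
  intro W _ _ p hp _ D hsq hp11 hadd hirr hGo hV4 hopt χ hχ hprim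
  -- generalise the level `N(W)` so that it can be rewritten as `p²M`
  suffices aux : ∀ (N : ℕ) [NeZero N] (_hNN : W.conductorNorm ℤ = N) (D : ModularParametrizationData W N)
      (hsq : p ^ 2 ∣ N), (∀ z ∈ D.L.lattice, ∃ w ∈ periodLattice D.f, z = D.c * w) →
      ∀ z ∈ periodLattice D.f, ∃ w ∈ periodLattice (charTwist N (dvd_refl _) hsq hχ D.f),
        z = gaussSum χ (ZMod.stdAddChar (N := p)) * w from aux _ rfl D hsq hopt
  intro N _ hNN D' hsq' hopt'
  obtain ⟨M, hM, hpM⟩ := conductorNorm_eq_sq_mul_coprime W p (by omega) (hNN ▸ hsq')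
  obtain rfl : N = p ^ 2 * M := hNN.symm.trans hM
  haveI : NeZero M := ⟨fun h => NeZero.ne (p ^ 2 * M) (by rw [h, mul_zero])⟩
  haveI : Fintype (diagTorus (ZMod p)) := Fintype.ofFinite _
  haveI : Invertible (Fintype.card (diagTorus (ZMod p)) : ℤ_[p]) := (isUnit_card_diagTorus p).invertible
  letI : Algebra ℤ_[p] (ZMod p) := (PadicInt.toZMod (p := p)).toAlgebra
  have hsurj : Surjective (algebraMap ℤ_[p] (ZMod p)) := ZMod.ringHom_surjective _
  have halg : ∀ x : ℤ_[p], algebraMap ℤ_[p] (ZMod p) x = ZMod.castHom (dvd_refl p) (ZMod p) (PadicInt.toZMod x) := fun x => by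
    rw [ZMod.castHom_self, RingHom.id_apply]; rfl
  obtain ⟨b, m, Ψ, hb, hb2, hΨ, hm, hsoc⟩ := hcar p M hpM W hM D' hp11 hadd hirr hGo hV4
  exact saturation_at_of_carrier_of_multOne p M hpM hnf W hM D' hp11 hadd hirr hGo hV4 hopt' χ hχ hprim hsurj halg hb hb2 Ψ hΨ
    hm hsoc (hM1 p M hpM W hM D')

end Summit.BirchSwinnertonDyer.BirchSwinnertonDyer.Theorems.TeichmullerTwistDescent.KOfCarrier
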